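import Mathlib
import HarnessLib
import Summits.HubbardSuperconductivity.HubbardSuperconductivity.Theorems.KLProgrammeKLRegimeVolumeLimitSecondOrderRateSymbols
import Summits.HubbardSuperconductivity.HubbardSuperconductivity.Theorems.KLProgrammeKLRegimeVolumeLimitRateEx
import Summits.HubbardSuperconductivity.HubbardSuperconductivity.Theorems.KLProgrammeKLRegimeVolumeLimitBoundDoor

/-!
# Route `KLProgramme` — VL child `KLRegimeVolumeLimitV12` (stmt-HubbardSuperconductivity-19858), Cauchy stub `stub_vl_twoVolumeRate`:
# THE DOOR — the registered two-volume stub follows from a BARE-FRAME uniform bound and a BARE-FRAME two-volume rate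
# (cell gate-hubbard-kl, seat hubbard-kl-k3c4-p1 g4; the rate twin of k3c5-p3's `stub_vl_bound_of_bareFrameBound`, `…VolumeLimitBoundDoor`)

By the frame covariance of the fully integrated countertermed two-leg kernel (`selfEnergy_fullActionCT_frame_covariance`, k3c5-p2; non-junk
cutoffs `D_{L,M}(U) ≠ 0`, reached beyond `exists_partitionFn_ne_zero_threshold` at every `L ≥ 3`),
`Σ̂^K_{L,M}((ω,k),σ) = d(n,p_k)² · Σ̂⁰_{L,M}((ω,k),σ) + K(p_k)·d(n,p_k)`, `d = ĝ₀/ĝ_K = 1 − K·g₀` (`klso_propCT_div_eq_dress`): the frame enters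
only through grid samples of the `L`-independent `2π`-periodic Lipschitz symbols `d²` and `K·d` (Lipschitz under `FrameOK`, `klso_dressSq_*`,
`klrd_frameTimesDress_*`).  Hence (`Rate∃` algebra of `…VolumeLimitRateEx` + `klre_congr`):

* `twoVolumeRate_frame_transfer_of_bare` — for `β > 0`, any `U`, `μ` and an ADMISSIBLE frame `K`: a uniform bound AND a two-volume rate of
  the BARE carrier beyond thresholds `(L₀, Mth)` give a two-volume rate of the frame-`K` carrier beyond `(max L₀ 3, max Mth MD)`;
* **`stub_vl_twoVolumeRate_of_bareFrameRate`** — THE DOOR: if for every `β > 0`, `U`, `μ` the bare carrier has a uniform bound and a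
  two-volume rate with cross-grid modulus beyond its own thresholds, then the REGISTERED text of `stub_vl_twoVolumeRate` (skeleton «cauchy»
  of stmt-19858) holds verbatim — the constant records, the regime and the tower are not used; admissibility of the frame is used only for
  the Lipschitz modulus of `K`.

With `twoVolumeRate_of_matsubaraLimit` (`…CauchyMatsubara`) the bare hypotheses split further into the cutoff direction (all-`U` lane) and the
volume direction of the cutoff-free objects (the engine's debt, ruling (α)).  Nothing is asserted about the model.
-/

noncomputable section

namespace Summit.HubbardSuperconductivity.HubbardSuperconductivity.Theorems.KLRegimeSplit

set_option linter.dupNamespace false -- summit = problem name (single-conjunct summit), D-0017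

open Filter Topology Finset Real Literature.MathematicalPhysics.QuantumLattice Literature.Probability.LatticeModels
open Literature.MathematicalPhysics.QuantumLattice.FermiRG
open Summit.HubbardSuperconductivity.HubbardSuperconductivity.Theorems.DispersionFlow
open Summit.HubbardSuperconductivity.HubbardSuperconductivity.Theorems.KLProgrammeLegKernels
open Summit.HubbardSuperconductivity.HubbardSuperconductivity.Theorems.TwoPointAssembly

/-! ## §1 `Rate∃` is invariant under eventual pointwise equality -/

/-- **Congruence**: a family that AGREES with a rated family beyond the thresholds is rated (same data). [folklore] -/
theorem klre_congr {S S' : ∀ (L M : ℕ) [NeZero L] [NeZero M], FreqMomentum L M → Fin 2 → ℂ} {L₀ : ℕ} {Mth : ℕ → ℕ}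
    (heq : ∀ (L : ℕ) [NeZero L], L₀ ≤ L → ∀ (M : ℕ) [NeZero M], Mth L ≤ M → ∀ (k : FreqMomentum L M) (σ : Fin 2),
      S' L M k σ = S L M k σ)
    (hS : ∃ D : ℝ, ∃ ρ : ℕ → ℝ, Tendsto ρ atTop (𝓝 0) ∧
      ∀ (L : ℕ) [NeZero L], L₀ ≤ L → ∀ (M : ℕ) [NeZero M], Mth L ≤ M →
        ∀ (L' : ℕ) [NeZero L'], L ≤ L' → ∀ (M' : ℕ) [NeZero M'], Mth L' ≤ M' →
          ∀ (σ : Fin 2) (ω : MatsubaraIdx M) (ω' : MatsubaraIdx M'), matsubaraInt M ω = matsubaraInt M' ω' →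
            ∀ (k : TorusSite 2 L) (k' : TorusSite 2 L'),
              ‖S L M (ω, k) σ - S L' M' (ω', k') σ‖ ≤ ρ L + D * ∑ i, torusAbs (latticeMomentum L k i - latticeMomentum L' k' i)) :
    ∃ D : ℝ, ∃ ρ : ℕ → ℝ, Tendsto ρ atTop (𝓝 0) ∧
      ∀ (L : ℕ) [NeZero L], L₀ ≤ L → ∀ (M : ℕ) [NeZero M], Mth L ≤ M →
        ∀ (L' : ℕ) [NeZero L'], L ≤ L' → ∀ (M' : ℕ) [NeZero M'], Mth L' ≤ M' →
          ∀ (σ : Fin 2) (ω : MatsubaraIdx M) (ω' : MatsubaraIdx M'), matsubaraInt M ω = matsubaraInt M' ω' →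
            ∀ (k : TorusSite 2 L) (k' : TorusSite 2 L'),
              ‖S' L M (ω, k) σ - S' L' M' (ω', k') σ‖ ≤ ρ L + D * ∑ i, torusAbs (latticeMomentum L k i - latticeMomentum L' k' i) := by
  obtain ⟨D, ρ, hρ, h⟩ := hS
  refine ⟨D, ρ, hρ, fun L _ hL M _ hM L' _ hLL' M' _ hM' σ ω ω' hωω' k k' => ?_⟩
  rw [heq L hL M hM (ω, k) σ, heq L' (hL.trans hLL') M' hM' (ω', k') σ]
  exact h L hL M hM L' hLL' M' hM' σ ω ω' hωω' k k'

/-! ## §2 The symbol `K(p)·d(n,p)` -/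

section Frame

variable {R : RenConsts} {U₁ : ℝ} {N : ℕ} {μ : ℝ} {K : TrigPolyC4v}

/-- Size: `‖K(p)·d(n,p)‖ ≤ ‖K‖₀·(1 + ‖K‖₀β/π)`. -/
theorem klrd_frameTimesDress_norm_le {β : ℝ} (hβ : 0 < β) (μ : ℝ) (K : TrigPolyC4v) (n : ℤ) (p : Fin 2 → ℝ) :
    ‖(K.eval p : ℂ) * (1 - (K.eval p : ℂ) * ((bandCT μ 0 p : ℂ) - Complex.I * (fermiMatsubara β n : ℂ))⁻¹)‖ ≤
      K.coeffNorm 0 * (1 + K.coeffNorm 0 * (β / Real.pi)) := by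
  rw [norm_mul, Complex.norm_real, Real.norm_eq_abs]
  exact mul_le_mul (TrigPolyC4v.abs_eval_le_coeffNorm K p) (klso_dress_norm_le hβ μ K n p) (norm_nonneg _)
    (TrigPolyC4v.coeffNorm_nonneg 0 K)

/-- Periodicity of `K(p)·d(n,p)` (`p + m·2π` convention). -/
theorem klrd_frameTimesDress_periodic (β μ : ℝ) (K : TrigPolyC4v) (n : ℤ) (p : Fin 2 → ℝ) (m : Fin 2 → ℤ) :
    (K.eval (fun i => p i + m i * (2 * Real.pi)) : ℂ) *
        (1 - (K.eval (fun i => p i + m i * (2 * Real.pi)) : ℂ) *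
          ((bandCT μ 0 (fun i => p i + m i * (2 * Real.pi)) : ℂ) - Complex.I * (fermiMatsubara β n : ℂ))⁻¹) =
      (K.eval p : ℂ) * (1 - (K.eval p : ℂ) * ((bandCT μ 0 p : ℂ) - Complex.I * (fermiMatsubara β n : ℂ))⁻¹) := by
  rw [klso_dress_periodic, TrigPolyC4v.eval_periodic]

/-- Lipschitz modulus of `K(p)·d(n,p)` under `FrameOK`: `((4+7√2)·Bd + ‖K‖₀·Ld)·‖x − y‖_∞`. -/
theorem klrd_frameTimesDress_sub_le {β : ℝ} (hβ : 0 < β) (hK : FrameOK R U₁ N μ K) (n : ℤ) (x y : Fin 2 → ℝ) :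
    ‖(K.eval x : ℂ) * (1 - (K.eval x : ℂ) * ((bandCT μ 0 x : ℂ) - Complex.I * (fermiMatsubara β n : ℂ))⁻¹) -
        (K.eval y : ℂ) * (1 - (K.eval y : ℂ) * ((bandCT μ 0 y : ℂ) - Complex.I * (fermiMatsubara β n : ℂ))⁻¹)‖ ≤
      ((4 + 7 * Real.sqrt 2) * (1 + K.coeffNorm 0 * (β / Real.pi)) +
          K.coeffNorm 0 * ((4 + 7 * Real.sqrt 2) * (β / Real.pi) + K.coeffNorm 0 * (4 * β ^ 2 / π ^ 2))) * ‖x - y‖ := by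
  set dx : ℂ := 1 - (K.eval x : ℂ) * ((bandCT μ 0 x : ℂ) - Complex.I * (fermiMatsubara β n : ℂ))⁻¹ with hdx
  set dy : ℂ := 1 - (K.eval y : ℂ) * ((bandCT μ 0 y : ℂ) - Complex.I * (fermiMatsubara β n : ℂ))⁻¹ with hdy
  have hdxn : ‖dx‖ ≤ 1 + K.coeffNorm 0 * (β / Real.pi) := klso_dress_norm_le hβ μ K n x
  have hdxy : ‖dx - dy‖ ≤ ((4 + 7 * Real.sqrt 2) * (β / Real.pi) + K.coeffNorm 0 * (4 * β ^ 2 / π ^ 2)) * ‖x - y‖ :=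
    klso_dress_sub_le hβ hK n x y
  have hKxy := klso_abs_eval_sub_le hK x y
  have hKy := TrigPolyC4v.abs_eval_le_coeffNorm K y
  have hK0 := TrigPolyC4v.coeffNorm_nonneg 0 K
  have hsplit : (K.eval x : ℂ) * dx - (K.eval y : ℂ) * dy = ((K.eval x : ℂ) - (K.eval y : ℂ)) * dx + (K.eval y : ℂ) * (dx - dy) := by
    ring
  rw [hsplit]
  calc ‖((K.eval x : ℂ) - (K.eval y : ℂ)) * dx + (K.eval y : ℂ) * (dx - dy)‖
      ≤ ‖((K.eval x : ℂ) - (K.eval y : ℂ)) * dx‖ + ‖(K.eval y : ℂ) * (dx - dy)‖ := norm_add_le _ _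
    _ = |K.eval x - K.eval y| * ‖dx‖ + |K.eval y| * ‖dx - dy‖ := by
        rw [norm_mul, norm_mul, ← Complex.ofReal_sub, Complex.norm_real, Complex.norm_real, Real.norm_eq_abs, Real.norm_eq_abs]
    _ ≤ (4 + 7 * Real.sqrt 2) * ‖x - y‖ * (1 + K.coeffNorm 0 * (β / Real.pi)) +
          K.coeffNorm 0 * (((4 + 7 * Real.sqrt 2) * (β / Real.pi) + K.coeffNorm 0 * (4 * β ^ 2 / π ^ 2)) * ‖x - y‖) :=
        add_le_add (mul_le_mul hKxy hdxn (norm_nonneg _) (by positivity)) (mul_le_mul hKy hdxy (norm_nonneg _) hK0)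
    _ = _ := by ring

end Frame

/-! ## §3 The carrier in the frame `K` from the bare carrier, beyond non-junk cutoffs -/

section Model

variable {L M : ℕ} [NeZero L] [NeZero M]

omit [NeZero M] in
/-- **Frame covariance with the bare frame, in symbol form**: for `β > 0` and a non-junk cutoff (`D_{L,M}(U) ≠ 0`),
`Σ̂^K_{L,M}((ω,k),σ) = d(n,p_k)²·Σ̂⁰_{L,M}((ω,k),σ) + K(p_k)·d(n,p_k)`, `d = 1 − K·g₀`. -/
theorem klrd_carrier_eq {β : ℝ} (hβ : 0 < β) (U μ : ℝ) (K : TrigPolyC4v) (ω : MatsubaraIdx M) (k : TorusSite 2 L) (σ : Fin 2)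
    (hD : effPartitionFn ℂ (hubbardCovariance L M β μ 0) (hubbardInteraction L M β U) ≠ 0) :
    klSelfEnergy L M β U μ K klE0 (nScales β + 1) (ω, k) σ =
      (1 - (K.eval (latticeMomentum L k) : ℂ) *
            ((bandCT μ 0 (latticeMomentum L k) : ℂ) - Complex.I * (fermiMatsubara β (matsubaraInt M ω) : ℂ))⁻¹) ^ 2 *
          klSelfEnergy L M β U μ 0 klE0 (nScales β + 1) (ω, k) σ +
        (K.eval (latticeMomentum L k) : ℂ) *
          (1 - (K.eval (latticeMomentum L k) : ℂ) *
            ((bandCT μ 0 (latticeMomentum L k) : ℂ) - Complex.I * (fermiMatsubara β (matsubaraInt M ω) : ℂ))⁻¹) := by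
  have h := selfEnergy_fullActionCT_frame_covariance hβ.ne' U μ K 0 (ω, k) σ hD
  rw [klso_propCT_div_eq_dress hβ.ne' μ K ω k, TrigPolyC4v.eval_zero, sub_zero] at h
  rw [klSelfEnergy, klSelfEnergy, klEffectiveAction_nScales_succ L M hβ, klEffectiveAction_nScales_succ L M hβ, ← fullActionCT,
    ← fullActionCT]
  exact h

end Model

/-! ## §4 The frame transfer of a two-volume rate, and the door -/

/-- **A bare-frame uniform bound and two-volume rate give a two-volume rate in every admissible frame.**  For `β > 0`, any `U`, `μ`,
`FrameOK R U₁ N μ K`, and bare data beyond `(L₀, Mth)`: there are thresholds `(L₀', Mth')` and `(D, ρ → 0)` with the two-volume inequality for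
`klSelfEnergy … K … (nScales β + 1)`. -/
theorem twoVolumeRate_frame_transfer_of_bare {β : ℝ} (hβ : 0 < β) (U μ : ℝ) {R : RenConsts} {U₁ : ℝ} {N : ℕ} {K : TrigPolyC4v}
    (hK : FrameOK R U₁ N μ K) {B₀ : ℝ} {L₀ : ℕ} {Mth : ℕ → ℕ}
    (hb : ∀ (L : ℕ) [NeZero L], L₀ ≤ L → ∀ (M : ℕ) [NeZero M], Mth L ≤ M →
      ∀ (k : FreqMomentum L M) (σ : Fin 2), ‖klSelfEnergy L M β U μ 0 klE0 (nScales β + 1) k σ‖ ≤ B₀)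
    (hr : ∃ D : ℝ, ∃ ρ : ℕ → ℝ, Tendsto ρ atTop (𝓝 0) ∧
      ∀ (L : ℕ) [NeZero L], L₀ ≤ L → ∀ (M : ℕ) [NeZero M], Mth L ≤ M →
        ∀ (L' : ℕ) [NeZero L'], L ≤ L' → ∀ (M' : ℕ) [NeZero M'], Mth L' ≤ M' →
          ∀ (σ : Fin 2) (ω : MatsubaraIdx M) (ω' : MatsubaraIdx M'), matsubaraInt M ω = matsubaraInt M' ω' →
            ∀ (k : TorusSite 2 L) (k' : TorusSite 2 L'),
              ‖klSelfEnergy L M β U μ 0 klE0 (nScales β + 1) (ω, k) σ - klSelfEnergy L' M' β U μ 0 klE0 (nScales β + 1) (ω', k') σ‖ ≤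
                ρ L + D * ∑ i, torusAbs (latticeMomentum L k i - latticeMomentum L' k' i)) :
    ∃ L₀' : ℕ, ∃ Mth' : ℕ → ℕ, ∃ D : ℝ, ∃ ρ : ℕ → ℝ, Tendsto ρ atTop (𝓝 0) ∧
      ∀ (L : ℕ) [NeZero L], L₀' ≤ L → ∀ (M : ℕ) [NeZero M], Mth' L ≤ M →
        ∀ (L' : ℕ) [NeZero L'], L ≤ L' → ∀ (M' : ℕ) [NeZero M'], Mth' L' ≤ M' →
          ∀ (σ : Fin 2) (ω : MatsubaraIdx M) (ω' : MatsubaraIdx M'), matsubaraInt M ω = matsubaraInt M' ω' →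
            ∀ (k : TorusSite 2 L) (k' : TorusSite 2 L'),
              ‖klSelfEnergy L M β U μ K klE0 (nScales β + 1) (ω, k) σ - klSelfEnergy L' M' β U μ K klE0 (nScales β + 1) (ω', k') σ‖ ≤
                ρ L + D * ∑ i, torusAbs (latticeMomentum L k i - latticeMomentum L' k' i) := by
  classical
  -- non-junk cutoff thresholds at every `L ≥ 3`
  set MD : ℕ → ℕ := fun L =>
    if h : 3 ≤ L then (by haveI : NeZero L := ⟨by omega⟩; exact Classical.choose (exists_partitionFn_ne_zero_threshold L h hβ μ U))
    else 0 with hMD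
  have hMD_spec : ∀ (L : ℕ) [NeZero L], 3 ≤ L → ∀ M : ℕ, MD L ≤ M →
      effPartitionFn ℂ (hubbardCovariance L M β μ 0) (hubbardInteraction L M β U) ≠ 0 := by
    intro L _ hL M hM
    have hspec := Classical.choose_spec (exists_partitionFn_ne_zero_threshold L hL hβ μ U)
    have hMD_eq : MD L = Classical.choose (exists_partitionFn_ne_zero_threshold L hL hβ μ U) := by simp only [hMD, dif_pos hL]
    rw [hMD_eq] at hM
    exact hspec M hM
  -- common thresholds
  set Lc : ℕ := max L₀ 3 with hLc
  set Mc : ℕ → ℕ := fun L => max (Mth L) (MD L) with hMc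
  have hL₀c : L₀ ≤ Lc := le_max_left _ _
  have h3c : 3 ≤ Lc := le_max_right _ _
  have hMthc : ∀ L, Mth L ≤ Mc L := fun L => le_max_left _ _
  have hMDc : ∀ L, MD L ≤ Mc L := fun L => le_max_right _ _
  -- the symbols
  set dsq : ℤ → (Fin 2 → ℝ) → ℂ := fun n p =>
    (1 - (K.eval p : ℂ) * ((bandCT μ 0 p : ℂ) - Complex.I * (fermiMatsubara β n : ℂ))⁻¹) ^ 2 with hdsq
  set Kd : ℤ → (Fin 2 → ℝ) → Fin 2 → ℂ := fun n p _ =>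
    (K.eval p : ℂ) * (1 - (K.eval p : ℂ) * ((bandCT μ 0 p : ℂ) - Complex.I * (fermiMatsubara β n : ℂ))⁻¹) with hKd
  have hK0 : 0 ≤ K.coeffNorm 0 := TrigPolyC4v.coeffNorm_nonneg 0 K
  set Bd : ℝ := 1 + K.coeffNorm 0 * (β / Real.pi) with hBd
  set Ld : ℝ := (4 + 7 * Real.sqrt 2) * (β / Real.pi) + K.coeffNorm 0 * (4 * β ^ 2 / π ^ 2) with hLd
  have hBd0 : 0 ≤ Bd := by positivity
  have hLd0 : 0 ≤ Ld := by positivity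
  -- the bare pieces at the common thresholds
  have hb' : ∀ (L : ℕ) [NeZero L], Lc ≤ L → ∀ (M : ℕ) [NeZero M], Mc L ≤ M →
      ∀ (k : FreqMomentum L M) (σ : Fin 2), ‖klSelfEnergy L M β U μ 0 klE0 (nScales β + 1) k σ‖ ≤ max B₀ 0 :=
    fun L _ hL M _ hM k σ => (hb L (hL₀c.trans hL) M ((hMthc L).trans hM) k σ).trans (le_max_left _ _)
  have hr' : _ := klre_mono (S := fun L M _ _ k σ => klSelfEnergy L M β U μ 0 klE0 (nScales β + 1) k σ) hL₀c hMthc hr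
  -- `d² · Σ̂⁰` and `K·d`
  have h1 : _ := klre_dressing_mul (S := fun L M _ _ k σ => klSelfEnergy L M β U μ 0 klE0 (nScales β + 1) k σ)
    (Φ := fun L M _ _ k => dsq (matsubaraInt M k.1) (latticeMomentum L k.2)) (φ := dsq) (Bφ := Bd ^ 2) (Kφ := 2 * Bd * Ld)
    (by positivity) (by positivity) (fun n p => klso_dressSq_norm_le hβ μ K n p) (fun n p m => klso_dressSq_periodic β μ K n p m)
    (fun n p q => klso_dressSq_sub_le hβ hK n p q) (fun _ _ _ _ _ _ => rfl) hb' hr'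
  have h2 : _ := klre_of_gridExact (S := fun L M _ _ k σ => Kd (matsubaraInt M k.1) (latticeMomentum L k.2) σ) (Mth := Mc) (L₀ := Lc)
    (φ := Kd) (Kφ := (4 + 7 * Real.sqrt 2) * Bd + K.coeffNorm 0 * Ld) (by positivity)
    (fun n σ p m => klrd_frameTimesDress_periodic β μ K n p m) (fun n σ p q => klrd_frameTimesDress_sub_le hβ hK n p q)
    (fun _ _ _ _ _ _ _ _ _ => rfl)
  have hsum : _ := klre_add
    (S := fun L M _ _ k σ => dsq (matsubaraInt M k.1) (latticeMomentum L k.2) * klSelfEnergy L M β U μ 0 klE0 (nScales β + 1) k σ)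
    (T := fun L M _ _ k σ => Kd (matsubaraInt M k.1) (latticeMomentum L k.2) σ) h1 h2
  -- the carrier agrees with `d²·Σ̂⁰ + K·d` beyond the thresholds
  have hfinal := klre_congr (S' := fun L M _ _ k σ => klSelfEnergy L M β U μ K klE0 (nScales β + 1) k σ)
    (S := fun L M _ _ k σ => dsq (matsubaraInt M k.1) (latticeMomentum L k.2) * klSelfEnergy L M β U μ 0 klE0 (nScales β + 1) k σ +
      Kd (matsubaraInt M k.1) (latticeMomentum L k.2) σ)
    (fun L _ hL M _ hM k σ => by
      obtain ⟨ω, kv⟩ := k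
      have hD := hMD_spec L (h3c.trans hL) M ((hMDc L).trans hM)
      simp only [hdsq, hKd]
      exact klrd_carrier_eq hβ U μ K ω kv σ hD) hsum
  obtain ⟨D, ρ, hρ, hrate⟩ := hfinal
  exact ⟨Lc, Mc, D, ρ, hρ, hrate⟩

/-- **THE DOOR FOR `stub_vl_twoVolumeRate` OF `KLRegimeVolumeLimitV12`.**  If for every `β > 0`, `U`, `μ` the BARE-FRAME fully integrated
two-leg kernel has, beyond the supplier's own thresholds `(L₀, Mth)`, a uniform bound AND a two-volume rate with cross-grid modulus
(`ρ → 0`), then the registered stub text holds verbatim (frame transfer `twoVolumeRate_frame_transfer_of_bare`; the constant records, the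
regime and the tower are not used, admissibility of the frame only through `K`'s Lipschitz modulus). -/
theorem stub_vl_twoVolumeRate_of_bareFrameRate
    (hbare : ∀ β : ℝ, 0 < β → ∀ U μ : ℝ, ∃ B₀ : ℝ, ∃ L₀ : ℕ, ∃ Mth : ℕ → ℕ, ∃ D : ℝ, ∃ ρ : ℕ → ℝ, Tendsto ρ atTop (𝓝 0) ∧
      (∀ (L : ℕ) [NeZero L], L₀ ≤ L → ∀ (M : ℕ) [NeZero M], Mth L ≤ M →
        ∀ (k : FreqMomentum L M) (σ : Fin 2), ‖klSelfEnergy L M β U μ 0 klE0 (nScales β + 1) k σ‖ ≤ B₀) ∧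
      (∀ (L : ℕ) [NeZero L], L₀ ≤ L → ∀ (M : ℕ) [NeZero M], Mth L ≤ M →
        ∀ (L' : ℕ) [NeZero L'], L ≤ L' → ∀ (M' : ℕ) [NeZero M'], Mth L' ≤ M' →
          ∀ (σ : Fin 2) (ω : MatsubaraIdx M) (ω' : MatsubaraIdx M'), matsubaraInt M ω = matsubaraInt M' ω' →
            ∀ (k : TorusSite 2 L) (k' : TorusSite 2 L'),
              ‖klSelfEnergy L M β U μ 0 klE0 (nScales β + 1) (ω, k) σ - klSelfEnergy L' M' β U μ 0 klE0 (nScales β + 1) (ω', k') σ‖ ≤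
                ρ L + D * ∑ i, torusAbs (latticeMomentum L k i - latticeMomentum L' k' i))) :
    ∀ (G : GeoConsts) (P : SplitConsts) (Q : EngConsts) (R : RenConsts), G.WF → P.WF → Q.WF → R.WF →
      ∃ c₅ : ℝ, 0 < c₅ ∧ ∀ c : ℝ, 0 < c → c ≤ c₅ → ∃ U₀ : ℝ, 0 < U₀ ∧
        ∀ μ ∈ klWindowC, ∀ U : ℝ, 0 < U → U ≤ U₀ → ∀ β : ℝ, klBetaMin ≤ β → β ≤ Real.exp (c / U ^ 2) →
          ∀ K : TrigPolyC4v, klPredsV12.frameOK R U (nScales β) μ K →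
            ∀ (Lstar : ℕ) (Mstar : ℕ → ℕ), TowerP klPredsV12 G P Q R β U μ K Lstar Mstar →
              ∃ L₀ : ℕ, ∃ Mth : ℕ → ℕ, ∃ D : ℝ, ∃ ρ : ℕ → ℝ, Tendsto ρ atTop (𝓝 0) ∧
                ∀ (L : ℕ) [NeZero L], L₀ ≤ L → ∀ (M : ℕ) [NeZero M], Mth L ≤ M →
                  ∀ (L' : ℕ) [NeZero L'], L ≤ L' → ∀ (M' : ℕ) [NeZero M'], Mth L' ≤ M' →
                    ∀ (σ : Fin 2) (ω : MatsubaraIdx M) (ω' : MatsubaraIdx M'), matsubaraInt M ω = matsubaraInt M' ω' →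
                      ∀ (k : TorusSite 2 L) (k' : TorusSite 2 L'),
                        ‖klSelfEnergy L M β U μ K klE0 (nScales β + 1) (ω, k) σ -
                            klSelfEnergy L' M' β U μ K klE0 (nScales β + 1) (ω', k') σ‖ ≤
                          ρ L + D * ∑ i, torusAbs (latticeMomentum L k i - latticeMomentum L' k' i) := by
  intro G P Q R _ _ _ _
  refine ⟨1, one_pos, fun c _ _ => ⟨1, one_pos, ?_⟩⟩
  intro μ _ U _ _ β hβmin _ K hK Lstar Mstar _
  have hβ : 0 < β := pos_of_klBetaMin_le hβmin
  obtain ⟨B₀, L₀, Mth, D, ρ, hρ, hb, hr⟩ := hbare β hβ U μ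
  exact twoVolumeRate_frame_transfer_of_bare hβ U μ hK hb ⟨D, ρ, hρ, hr⟩

end Summit.HubbardSuperconductivity.HubbardSuperconductivity.Theorems.KLRegimeSplit

end
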